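import Mathlib
import Summits.MatrixMultiplication.MatrixMultiplication.Theorems.LevelGradedCohnUmansLevelOneGL2DesignsQuadraticLiftExponent

/-!
# The residual of the quadratic-lift axis: SRS exponent `1/2 + γ` from square-difference-free exponent `γ`
(wall-breaker k8 for `stub_tangencySets`, crux `LevelOneGL2Designs`, stmt-MatrixMultiplication-14080; the
"reduced-to" of AXIS.md, kernel-checked)

`srs_of_sqDiffFree_exponent` — let `d` be a non-square with `|d| ≤ 2` and suppose the boxes `[0,L)²` of
`ℤ√d` carry square-difference-free sets of size `≥ c·(L²)^γ` for every `L` (`0 ≤ γ ≤ 1`, `c > 0`).  Then for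
every prime `p` at which `d` has a square root (`φ : ℤ√d →+* 𝔽_p`) there is a strong representative system of
`AG(2,p)` with at least `(c/156800)·p^{1/2+γ}` flags: lift the box `[0,m)²`, `m = ⌊(p/35)^{1/4}⌋`, against
the set at scale `L = m²` (`QuadraticLift.quadLift_box_srs`).

Reading.  The axis turns `stub_tangencySets` (exponent `3/2`) into the case `γ = 1` — POSITIVE-DENSITY
square-difference-free sets in the boxes of a quadratic order (`stub_tangencySets_of_denseSqDiffFree`, the
stub's signature verbatim as conclusion, via the primes `p ≡ 1 (mod 8)`, where `2` is a square).  That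
hypothesis is false (multidimensional Furstenberg–Sárközy: such sets have density `o(1)`; not in Mathlib), so
the implication records exactly where the axis stops; the digit method realises `γ = 3/4`
(`…QuadraticLiftDigits`, `…QuadraticLiftExponent`: exponent `5/4` unconditionally) and no more
(`…QuadraticLiftResidueCap`).  Elementary; no definitions.
-/

-- justification: the summit/problem path `MatrixMultiplication.MatrixMultiplication` is fixed by the
-- tree layout (D-0017), so the namespace necessarily repeats a component.
set_option linter.dupNamespace false

open Matrix Finset

namespace Summit.MatrixMultiplication.MatrixMultiplication.Theorems.LevelOneGL2Designs.QuadraticLift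

/-- `560^{1/2+γ} ≤ 13440` for `γ ≤ 1` (`√560 < 24`). [elementary] -/
theorem rpow_560_le {γ : ℝ} (hγ : γ ≤ 1) : (560 : ℝ) ^ (1 / 2 + γ) ≤ 13440 := by
  have h1 : (560 : ℝ) ^ (1 / 2 + γ) ≤ (560 : ℝ) ^ (3 / 2 : ℝ) :=
    Real.rpow_le_rpow_of_exponent_le (by norm_num) (by linarith)
  have h2 : (560 : ℝ) ^ (3 / 2 : ℝ) = 560 * Real.sqrt 560 := by
    rw [show (3 / 2 : ℝ) = 1 + 1 / 2 by norm_num, Real.rpow_add (by norm_num), Real.rpow_one,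
      Real.sqrt_eq_rpow]
  have h3 : Real.sqrt 560 ≤ 24 := by
    rw [Real.sqrt_le_left (by norm_num)]
    norm_num
  calc (560 : ℝ) ^ (1 / 2 + γ) ≤ 560 * Real.sqrt 560 := h1.trans h2.le
    _ ≤ 560 * 24 := by gcongr
    _ = 13440 := by norm_num

set_option maxHeartbeats 400000 in
/-- **The residual of the axis.**  Square-difference-free sets of exponent `γ ∈ [0,1]` in the boxes of a
quadratic order `ℤ√d` (`d` non-square, `|d| ≤ 2`) lift, at every prime where `d` is a square, to strong
representative systems of `AG(2,p)` of exponent `1/2 + γ`, with constant `c/156800`. [elementary] -/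
theorem srs_of_sqDiffFree_exponent {d : ℤ} (hd : ∀ n : ℤ, d ≠ n * n) (hd2 : |d| ≤ 2) {γ c : ℝ}
    (hγ0 : 0 ≤ γ) (hγ1 : γ ≤ 1) (hc : 0 < c)
    (h : ∀ L : ℕ, ∃ K : Finset (ℤ√d), c * ((L : ℝ) ^ 2) ^ γ ≤ K.card ∧
      (∀ k ∈ K, 0 ≤ k.re ∧ k.re < L ∧ 0 ≤ k.im ∧ k.im < L) ∧
      ∀ k ∈ K, ∀ k' ∈ K, ∀ z : ℤ√d, k - k' = z * z → z = 0)
    {p : ℕ} [Fact p.Prime] (φ : ℤ√d →+* ZMod p) :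
    ∃ S : Finset ((Fin 2 → ZMod p) × (Fin 2 → ZMod p)),
      c / 156800 * (p : ℝ) ^ (1 / 2 + γ) ≤ S.card ∧
      ∀ f ∈ S, ∀ f' ∈ S, (dotProduct f.1 f'.2 = 1 ↔ f = f') := by
  have hp := (Fact.out : p.Prime)
  have hp1 : (1 : ℝ) ≤ p := by exact_mod_cast hp.one_lt.le
  -- `c ≤ 1`: the box `[0,1)²` holds at most one element
  have hc1 : c ≤ 1 := by
    obtain ⟨K, hKc, hKbox, -⟩ := h 1
    have hK1 : K.card ≤ 1 := by
      rw [card_le_one]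
      intro a ha b hb
      obtain ⟨h1, h2, h3, h4⟩ := hKbox a ha
      obtain ⟨h1', h2', h3', h4'⟩ := hKbox b hb
      push_cast at h2 h4 h2' h4'
      exact Zsqrtd.ext (by omega) (by omega)
    have : c * (((1 : ℕ) : ℝ) ^ 2) ^ γ = c := by simp
    rw [this] at hKc
    have : (K.card : ℝ) ≤ 1 := by exact_mod_cast hK1
    linarith
  -- the scale `m = ⌊⌊p/35⌋^{1/4}⌋`
  set q : ℕ := p / 35 with hq
  set r : ℕ := Nat.sqrt q with hr
  set m : ℕ := Nat.sqrt r with hm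
  have hr1 : r * r ≤ q := Nat.sqrt_le q
  have hr2 : q < (r + 1) * (r + 1) := Nat.lt_succ_sqrt q
  have hm1 : m * m ≤ r := Nat.sqrt_le r
  have hm2 : r < (m + 1) * (m + 1) := Nat.lt_succ_sqrt r
  have h35 : 35 * q ≤ p := Nat.mul_div_le p 35
  have hp35 : p < 35 * (q + 1) := by omega
  rcases lt_or_ge m 2 with hsmall | hlarge
  · -- small primes (`p < 560`): one flag
    obtain ⟨S, hS, hsrs⟩ := exists_srs_card_one (p := p)
    refine ⟨S, ?_, hsrs⟩
    have hr3 : r ≤ 3 := by nlinarith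
    have hq15 : q ≤ 15 := by nlinarith
    have hp560 : (p : ℝ) ≤ 560 := by exact_mod_cast (by omega : p ≤ 560)
    have hpow : (p : ℝ) ^ (1 / 2 + γ) ≤ 13440 :=
      calc (p : ℝ) ^ (1 / 2 + γ) ≤ (560 : ℝ) ^ (1 / 2 + γ) :=
            Real.rpow_le_rpow (by positivity) hp560 (by linarith)
        _ ≤ 13440 := rpow_560_le hγ1
    have h1' : (1 : ℝ) ≤ S.card := by exact_mod_cast hS
    calc c / 156800 * (p : ℝ) ^ (1 / 2 + γ) ≤ 1 / 156800 * 13440 := by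
          gcongr
      _ ≤ 1 := by norm_num
      _ ≤ S.card := h1'
  · -- the lift at scale `L = m²`
    set L : ℕ := m * m with hL
    obtain ⟨K, hKc, hKbox, hK⟩ := h L
    have hLp : 34 * L ^ 2 < p := by
      have : L * L ≤ q := le_trans (Nat.mul_le_mul hm1 hm1) hr1
      have hp0 : 0 < p := hp.pos
      nlinarith
    obtain ⟨S, hS, hsrs⟩ := srs_of_sqDiffFree_box hd hd2 φ m L hL.symm K hKbox hK hLp
    refine ⟨S, ?_, hsrs⟩
    -- `p < 560 · m⁴`
    have hm4 : p < 560 * (m * m * (m * m)) := by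
      have h1 : q + 1 ≤ (r + 1) * (r + 1) := hr2
      have h2 : r + 1 ≤ (m + 1) * (m + 1) := hm2
      have h3 : (m + 1) ≤ 2 * m := by omega
      have h4 : (r + 1) * (r + 1) ≤ ((m + 1) * (m + 1)) * ((m + 1) * (m + 1)) :=
        Nat.mul_le_mul h2 h2
      have h5 : (m + 1) * (m + 1) ≤ (2 * m) * (2 * m) := Nat.mul_le_mul h3 h3
      nlinarith
    have hm0 : (0 : ℝ) < m := by exact_mod_cast (by omega : 0 < m)
    have hm4' : (p : ℝ) / 560 ≤ (m : ℝ) ^ 4 := by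
      rw [div_le_iff₀ (by norm_num)]
      have : (p : ℝ) < 560 * ((m : ℝ) * m * (m * m)) := by exact_mod_cast hm4
      nlinarith
    -- `(p/560)^{1/2+γ} ≤ m² · (m⁴)^γ`
    have hkey : ((p : ℝ) / 560) ^ (1 / 2 + γ) ≤ (m : ℝ) ^ 2 * ((m : ℝ) ^ 4) ^ γ := by
      rw [Real.rpow_add (by positivity)]
      refine mul_le_mul ?_ (Real.rpow_le_rpow (by positivity) hm4' hγ0) (by positivity)
        (by positivity)
      calc ((p : ℝ) / 560) ^ (1 / 2 : ℝ) ≤ ((m : ℝ) ^ 4) ^ (1 / 2 : ℝ) :=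
            Real.rpow_le_rpow (by positivity) hm4' (by norm_num)
        _ = (m : ℝ) ^ 2 := by
            rw [← Real.sqrt_eq_rpow, show (m : ℝ) ^ 4 = ((m : ℝ) ^ 2) ^ 2 by ring,
              Real.sqrt_sq (by positivity)]
    -- `|S| ≥ (L - 2)|K| ≥ (m²/2) · c (m⁴)^γ`
    have hS' : (L : ℝ) * K.card ≤ S.card + 2 * K.card := by exact_mod_cast hS
    have hL4 : (4 : ℝ) ≤ L := by
      have : 4 ≤ L := by rw [hL]; nlinarith
      exact_mod_cast this
    have hLm : (L : ℝ) = (m : ℝ) ^ 2 := by rw [hL]; push_cast; ring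
    have hKc' : c * ((m : ℝ) ^ 4) ^ γ ≤ K.card := by
      have : ((L : ℝ) ^ 2) = (m : ℝ) ^ 4 := by rw [hLm]; ring
      rw [this] at hKc
      exact hKc
    have hK0 : (0 : ℝ) ≤ K.card := by positivity
    have hSge : (L : ℝ) / 2 * K.card ≤ S.card := by nlinarith
    have hdiv : ((p : ℝ) / 560) ^ (1 / 2 + γ) = (p : ℝ) ^ (1 / 2 + γ) / (560 : ℝ) ^ (1 / 2 + γ) :=
      Real.div_rpow (by positivity) (by norm_num) _
    have h560 : (0 : ℝ) < (560 : ℝ) ^ (1 / 2 + γ) := by positivity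
    have hpγ : (0 : ℝ) ≤ (p : ℝ) ^ (1 / 2 + γ) := by positivity
    calc c / 156800 * (p : ℝ) ^ (1 / 2 + γ)
        ≤ c / 2 * ((p : ℝ) ^ (1 / 2 + γ) / (560 : ℝ) ^ (1 / 2 + γ)) := by
          have hY := rpow_560_le hγ1
          rw [show c / 2 * ((p : ℝ) ^ (1 / 2 + γ) / (560 : ℝ) ^ (1 / 2 + γ))
              = (c * (p : ℝ) ^ (1 / 2 + γ)) / (2 * (560 : ℝ) ^ (1 / 2 + γ)) by
                field_simp,
            show c / 156800 * (p : ℝ) ^ (1 / 2 + γ) = (c * (p : ℝ) ^ (1 / 2 + γ)) / 156800 by ring]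
          exact div_le_div_of_nonneg_left (by positivity) (by positivity) (by linarith)
      _ = c / 2 * ((p : ℝ) / 560) ^ (1 / 2 + γ) := by rw [hdiv]
      _ ≤ c / 2 * ((m : ℝ) ^ 2 * ((m : ℝ) ^ 4) ^ γ) := by gcongr
      _ = (m : ℝ) ^ 2 / 2 * (c * ((m : ℝ) ^ 4) ^ γ) := by ring
      _ ≤ (L : ℝ) / 2 * K.card := by
          rw [← hLm]
          exact mul_le_mul_of_nonneg_left hKc' (by positivity)
      _ ≤ S.card := hSge

/-- **`stub_tangencySets` from positive-density square-difference-free sets in `ℤ[√2]`-boxes** (the case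
`γ = 1` of the residual; the conclusion is the stub's signature verbatim).  The primes used are
`p ≡ 1 (mod 8)` (infinitely many, Mathlib's cyclotomic argument), where `2` is a square. [elementary] -/
theorem stub_tangencySets_of_denseSqDiffFree
    (h : ∃ c : ℝ, 0 < c ∧ ∀ L : ℕ, ∃ K : Finset (ℤ√2), c * (L : ℝ) ^ 2 ≤ K.card ∧
      (∀ k ∈ K, 0 ≤ k.re ∧ k.re < L ∧ 0 ≤ k.im ∧ k.im < L) ∧
      ∀ k ∈ K, ∀ k' ∈ K, ∀ z : ℤ√2, k - k' = z * z → z = 0) :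
    ∃ c : ℝ, 0 < c ∧ ∀ p₀ : ℕ, ∃ (p : ℕ) (_ : Fact p.Prime), p₀ ≤ p ∧
      ∃ S : Finset ((Fin 2 → ZMod p) × (Fin 2 → ZMod p)),
        c * (p : ℝ) ^ (3 / 2 : ℝ) ≤ S.card ∧
        ∀ f ∈ S, ∀ f' ∈ S, (dotProduct f.1 f'.2 = 1 ↔ f = f') := by
  obtain ⟨c, hc, hfam⟩ := h
  refine ⟨c / 156800, by positivity, fun p₀ => ?_⟩
  obtain ⟨p, hp, hp₀, hmod⟩ := Nat.exists_prime_gt_modEq_one p₀ (by norm_num : (8 : ℕ) ≠ 0)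
  haveI : Fact p.Prime := ⟨hp⟩
  have hp2 : p ≠ 2 := by
    intro h2
    rw [h2] at hmod
    exact absurd hmod (by decide)
  have h8 : p % 8 = 1 := by
    have := hmod
    rw [Nat.ModEq] at this
    omega
  obtain ⟨s, hs⟩ := (ZMod.exists_sq_eq_two_iff hp2).mpr (Or.inl h8)
  let φ : ℤ√2 →+* ZMod p := Zsqrtd.lift ⟨s, by rw [← hs]; norm_num⟩
  obtain ⟨S, hS, hsrs⟩ := srs_of_sqDiffFree_exponent two_ne_mul_self (by norm_num) zero_le_one le_rfl hc
    (fun L => by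
      obtain ⟨K, h1, h2, h3⟩ := hfam L
      exact ⟨K, by rw [Real.rpow_one]; exact h1, h2, h3⟩) φ
  refine ⟨p, ⟨hp⟩, hp₀.le, S, ?_, hsrs⟩
  have : (1 / 2 + 1 : ℝ) = 3 / 2 := by norm_num
  rw [this] at hS
  exact hS

end Summit.MatrixMultiplication.MatrixMultiplication.Theorems.LevelOneGL2Designs.QuadraticLift
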